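import Literature.NumberTheory.LFunctions.RamanujanDivisorSquare
import Mathlib.NumberTheory.LSeries.DirichletContinuation
import HarnessLib

/-!
# The Dirichlet series of `ν(n)² = (∑_{d ∣ n} χ(d))²` for a quadratic character, closed form:
# `∑ ν(n)² n^{−s} · ζ(2s) · ∏_{p ∣ D} (1 + p^{−s}) = ζ(s)² L(s, χ)²` (`Re s > 1`)

Topic `Literature/NumberTheory/LFunctions`. Everything in this file is PROVED (theorems only; no
definition, no named fact). It is a thin corollary layer over
`Literature/NumberTheory/LFunctions/RamanujanDivisorSquare.lean`, which proves — for ANY Dirichlet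
character `χ` mod `N`, with `ν_χ = divisorSumChar χ`, `ν_χ(n) = ∑_{d ∣ n} χ(d)` — the Euler-product
identity `(∑ ν_χ(n)² n^{−s}) · L(2s, χ²) = ζ(s) · L(s, χ²) · L(s, χ)²`
(`Literature.NumberTheory.LFunctions.LSeries_divisorSumChar_sq_mul_LSeries`) and Zhang's display
`∑ ν(n)² n^{−s} = ζ(s)² L(s,χ)² ∏_{(p,D)=1}(1 − p^{−2s}) ∏_{p∣D}(1 − p^{−s})` for `χ² = 1`
(`Literature.NumberTheory.LFunctions.LSeries_divisorSumChar_sq_of_sq_eq_one`).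

(An earlier version of this file, p188000, re-derived that identity from scratch by Euler
products; it duplicated `RamanujanDivisorSquare.lean` and is replaced by the present corollaries,
which use the tree's `divisorSumChar` throughout.)

For a QUADRATIC character `χ` mod `D ≥ 1` (`χ² = 1`, so `χ²` is the principal character `𝟙_D`,
`L(w, 𝟙_D) = ζ(w) ∏_{p ∣ D}(1 − p^{−w})` —
`Literature.NumberTheory.LFunctions.LSeries_one_mod_eq_riemannZeta_mul`) the identity becomes, after
cancelling the non-zero finite product `∏_{p ∣ D}(1 − p^{−s})` from
`1 − p^{−2s} = (1 − p^{−s})(1 + p^{−s})`, the CLOSED FORM with the Riemann zeta function and a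
finite Euler factor only:

* `LSeries_divisorSumChar_sq_mul_zeta_two_mul` —
  **`(∑_{n ≥ 1} ν(n)² n^{−s}) · ζ(2s) · ∏_{p ∣ D} (1 + p^{−s}) = ζ(s)² · L(s, χ)²`** (`Re s > 1`);
* `LSeries_divisorSumChar_sq_eq_div`, `LSeries_divisorSumChar_sq_eq_div_LFunction` — the solved form
  `∑ ν(n)² n^{−s} = ζ(s)² L(s, χ)² / (ζ(2s) ∏_{p ∣ D} (1 + p^{−s}))`, with Mathlib's `L`-series resp.
  completed `χ.LFunction` (`zeta_two_mul_mul_prod_ne_zero`: the denominator is non-zero).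

This is the function `φ(s) := ζ(s)^{−2} L(s,χ)^{−2} ∑ ν(n)² n^{−s}` of Y. Zhang, arXiv:2211.02515,
§3 (proof of Lemma 3.1) in closed form, `φ(s) = ζ(2s)^{−1} ∏_{p ∣ D}(1 + p^{−s})^{−1}`: his (3.3)
("`φ` is analytic for `σ > ½`", "`φ(s) ≪ ∏_{p∣D} |1 − p^{−s}|` for `σ ≥ σ₁ > ½`") and his local
factors "`φ_p = 1 + O(p^{−2σ})` (`p ∤ D`)", "`φ_p = (1 − p^{−s})(1 + O(p^{−2σ}))` (`p ∣ D`)" are read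
off from it (`φ_p = 1 − p^{−2s}` resp. `(1 − p^{−s})(1 − p^{−2s})^{−1}`). Only the DEFINITIONS of that
manuscript (under audit in this tree) are used; no statement about its theorems is implied.

## References

* E. C. Titchmarsh, *The Theory of the Riemann Zeta-Function*, 2nd ed. (OUP 1986), §1.2 (1.2.10),
  §1.3 (1.3.3). [cite: Titchmarsh1986, §1.2 (1.2.10)]
* Y. Zhang, *Discrete mean estimates and the Landau–Siegel zero*, arXiv:2211.02515 (2022), §3,
  (3.1)–(3.3); §17, proof of Lemma 17.1. [cite: Zhang2022LandauSiegel, §3 (3.3)]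
-/

noncomputable section

open Complex Finset Filter Topology
open scoped LSeries.notation

namespace Literature.NumberTheory.LFunctions.DivisorSumCharSq

variable {D : ℕ} (χ : DirichletCharacter ℂ D)

/-- `ζ(2s) ∏_{p ∣ D}(1 + p^{−s}) ≠ 0` for `Re s > 1` (`ζ(2s) ≠ 0`, and `‖p^{−s}‖ = p^{−σ} < 1`).
[folklore] -/
theorem zeta_two_mul_mul_prod_ne_zero {s : ℂ} (hs : 1 < s.re) :
    riemannZeta (2 * s) * ∏ p ∈ D.primeFactors, (1 + (p : ℂ) ^ (-s)) ≠ 0 := by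
  refine mul_ne_zero (riemannZeta_ne_zero_of_one_lt_re ?_)
    (Finset.prod_ne_zero_iff.2 fun p hp => ?_)
  · simp only [mul_re, re_ofNat, im_ofNat, zero_mul, sub_zero]; linarith
  · have hp' := Nat.prime_of_mem_primeFactors hp
    have h1 : ‖(p : ℂ) ^ (-s)‖ < 1 := by
      rw [norm_natCast_cpow_of_pos hp'.pos, neg_re]
      exact Real.rpow_lt_one_of_one_lt_of_neg (by exact_mod_cast hp'.one_lt) (by linarith)
    intro h
    have : (p : ℂ) ^ (-s) = -1 := by linear_combination h
    rw [this, norm_neg, norm_one] at h1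
    exact lt_irrefl _ h1

/-- `∏_{p ∣ D}(1 − p^{−s}) ≠ 0` for `Re s > 0`. [folklore] -/
theorem prod_one_sub_cpow_ne_zero {s : ℂ} (hs : 0 < s.re) :
    ∏ p ∈ D.primeFactors, (1 - (p : ℂ) ^ (-s)) ≠ 0 := by
  refine Finset.prod_ne_zero_iff.2 fun p hp => ?_
  have hp' := Nat.prime_of_mem_primeFactors hp
  have h1 : ‖(p : ℂ) ^ (-s)‖ < 1 := by
    rw [norm_natCast_cpow_of_pos hp'.pos, neg_re]
    exact Real.rpow_lt_one_of_one_lt_of_neg (by exact_mod_cast hp'.one_lt) (by linarith)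
  intro h
  rw [sub_eq_zero] at h
  rw [← h, norm_one] at h1
  exact lt_irrefl _ h1

/-- `∏_{p ∣ D}(1 − p^{−2s}) = ∏_{p ∣ D}(1 − p^{−s}) · ∏_{p ∣ D}(1 + p^{−s})`. [folklore] -/
theorem prod_one_sub_cpow_two_mul (s : ℂ) :
    ∏ p ∈ D.primeFactors, (1 - (p : ℂ) ^ (-(2 * s))) =
      (∏ p ∈ D.primeFactors, (1 - (p : ℂ) ^ (-s))) *
        ∏ p ∈ D.primeFactors, (1 + (p : ℂ) ^ (-s)) := by
  rw [← Finset.prod_mul_distrib]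
  refine Finset.prod_congr rfl fun p _ => ?_
  rw [show -(2 * s) = (2 : ℕ) * (-s) by push_cast; ring, cpow_nat_mul]
  ring

/-- **The Dirichlet series of `ν²` in closed form** (`χ` quadratic mod `D ≥ 1`, `Re s > 1`):
`(∑_{n ≥ 1} ν(n)² n^{−s}) · ζ(2s) · ∏_{p ∣ D} (1 + p^{−s}) = ζ(s)² · L(s, χ)²`, where
`ν = divisorSumChar χ`, `ν(n) = ∑_{d ∣ n} χ(d)`. From the tree's
`LSeries_divisorSumChar_sq_mul_LSeries` (`(∑ν²n^{−s})·L(2s,χ²) = ζ(s)L(s,χ²)L(s,χ)²`) with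
`χ² = 𝟙_D`, `L(w, 𝟙_D) = ζ(w)∏_{p∣D}(1 − p^{−w})` and `1 − p^{−2s} = (1 − p^{−s})(1 + p^{−s})`.
[cite: Titchmarsh1986, §1.3 (1.3.3)] [cite: Zhang2022LandauSiegel, §3 (3.3)] -/
theorem LSeries_divisorSumChar_sq_mul_zeta_two_mul [NeZero D] (hχ : χ ^ 2 = 1) {s : ℂ}
    (hs : 1 < s.re) :
    L (fun n => divisorSumChar χ n ^ 2) s *
        (riemannZeta (2 * s) * ∏ p ∈ D.primeFactors, (1 + (p : ℂ) ^ (-s))) =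
      riemannZeta s ^ 2 * (L ↗χ s) ^ 2 := by
  have h2s : 1 < (2 * s).re := by
    simp only [mul_re, re_ofNat, im_ofNat, zero_mul, sub_zero]; linarith
  have h := LSeries_divisorSumChar_sq_mul_LSeries χ hs
  rw [hχ, LSeries_one_mod_eq_riemannZeta_mul h2s, LSeries_one_mod_eq_riemannZeta_mul hs,
    prod_one_sub_cpow_two_mul] at h
  -- cancel the non-zero factor `∏_{p ∣ D}(1 − p^{−s})`
  have hP := prod_one_sub_cpow_ne_zero (D := D) (s := s) (by linarith)
  have key : (L (fun n => divisorSumChar χ n ^ 2) s *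
      (riemannZeta (2 * s) * ∏ p ∈ D.primeFactors, (1 + (p : ℂ) ^ (-s))) -
        riemannZeta s ^ 2 * (L ↗χ s) ^ 2) * ∏ p ∈ D.primeFactors, (1 - (p : ℂ) ^ (-s)) = 0 := by
    linear_combination h
  rcases mul_eq_zero.1 key with h0 | h0
  · exact sub_eq_zero.1 h0
  · exact absurd h0 hP

/-- **Solved form**: for `χ` quadratic mod `D ≥ 1` and `Re s > 1`,
`∑ ν(n)² n^{−s} = ζ(s)² L(s, χ)² / (ζ(2s) ∏_{p ∣ D} (1 + p^{−s}))` — Zhang's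
`φ(s) = ζ(2s)^{−1} ∏_{p∣D}(1 + p^{−s})^{−1}` in `∑ ν(n)² n^{−s} = ζ(s)² L(s,χ)² φ(s)`.
[cite: Zhang2022LandauSiegel, §3 (3.3)] -/
theorem LSeries_divisorSumChar_sq_eq_div [NeZero D] (hχ : χ ^ 2 = 1) {s : ℂ} (hs : 1 < s.re) :
    L (fun n => divisorSumChar χ n ^ 2) s =
      riemannZeta s ^ 2 * (L ↗χ s) ^ 2 /
        (riemannZeta (2 * s) * ∏ p ∈ D.primeFactors, (1 + (p : ℂ) ^ (-s))) := by
  rw [eq_div_iff (zeta_two_mul_mul_prod_ne_zero hs)]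
  exact LSeries_divisorSumChar_sq_mul_zeta_two_mul χ hχ hs

/-- The same with Mathlib's completed `L`-function `χ.LFunction` (equal to the series for
`Re s > 1`). [cite: Zhang2022LandauSiegel, §3 (3.3)] -/
theorem LSeries_divisorSumChar_sq_eq_div_LFunction [NeZero D] (hχ : χ ^ 2 = 1) {s : ℂ}
    (hs : 1 < s.re) :
    L (fun n => divisorSumChar χ n ^ 2) s =
      riemannZeta s ^ 2 * (χ.LFunction s) ^ 2 /
        (riemannZeta (2 * s) * ∏ p ∈ D.primeFactors, (1 + (p : ℂ) ^ (-s))) := by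
  rw [DirichletCharacter.LFunction_eq_LSeries χ hs]
  exact LSeries_divisorSumChar_sq_eq_div χ hχ hs

end Literature.NumberTheory.LFunctions.DivisorSumCharSq

end
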